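import Summits.Parity.GeneralizedHardyLittlewood.Theorems.LeeYangFibresRelativeDimOneSplitDefs
import HarnessLib

/-!
# The coset discrepancy, abstract form (crux stmt-Parity-14113 `LeeYangFibres.RelativeDimOne`,
line gallagher-backwards-split, stub `stub_inversion`, PIECE 3d)

Hypothesis (A) of `IncidenceRigidity` for `E = M_f − M_g` (core spectrum minus singular-series
spectrum) asks that `Σ_{b ∈ C*} (M_f(b) − M_g(b))` be small over the non-degenerate part `C*` of
every box-coset `C`. This file isolates the purely algebraic step of that estimate: from
* the core on the window (`|S_b − β M_f(b)| ≤ ε₁ (β |M_f(b)| + N)`, `|M_f(b)| ≤ C₀ (𝔖(b) + 1)` on `C*`),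
* the bandlimited singular series (`|𝔖(b) − M_g(b)| ≤ ε₂` on `C*`),
* the evaluated dictionary (`|Σ_{b ∈ C} S_b − W · LTF · P| ≤ E₄`, from `MovingClassMoments` and the
  local identity; `P = ∏ (X_i+1)/q^t`, `LTF = ∏_{p ∣ q} β_p(a,c)`),
* the coset singular mean (`|Σ_{C*} 𝔖 − LTF · #C| ≤ E₅`),
* the crude bound `0 ≤ S_b ≤ S_max` and the counts `#(C ∖ C*) ≤ Deg`, `|#C − P| ≤ ρ P`,
we get (`coset_discrepancy_abstract`)

  `|Σ_{C*} (M_f − M_g)| ≤ |W/β − 1| LTF P + (E₄ + Deg S_max)/β + ε₁ C₀ (LTF #C + E₅ + #C*)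
      + ε₁ N #C* / β + E₅ + ε₂ #C* + LTF ρ P`.

Everything is stated over an abstract finite index set, so that the estimate is independent of
how the data boxes are eventually chosen.
-/

noncomputable section

open scoped BigOperators Classical Topology
open Finset Filter MeasureTheory Literature.NumberTheory.Sieve

namespace Summit.Parity.GeneralizedHardyLittlewood.Cruxes.RelativeDimOne.GallagherBackwardsSplit

/-- Summing the core estimate: `|Σ_{C*} F − (Σ_{C*} S)/β| ≤ ε₁ Σ_{C*} |F| + ε₁ N #C* / β`. -/
theorem abs_sum_sub_sum_div_le {ι : Type*} (Cs : Finset ι) (F S : ι → ℝ) {β ε₁ N : ℝ} (hβ : 0 < β)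
    (h1 : ∀ b ∈ Cs, |S b - β * F b| ≤ ε₁ * (β * |F b| + N)) :
    |∑ b ∈ Cs, F b - (∑ b ∈ Cs, S b) / β| ≤ ε₁ * ∑ b ∈ Cs, |F b| + ε₁ * N * Cs.card / β := by
  have hterm : ∀ b ∈ Cs, |F b - S b / β| ≤ ε₁ * |F b| + ε₁ * N / β := by
    intro b hb
    have h := h1 b hb
    have : F b - S b / β = -(S b - β * F b) / β := by field_simp; ring
    rw [this, abs_div, abs_neg, abs_of_pos hβ, div_le_iff₀ hβ]
    calc |S b - β * F b| ≤ ε₁ * (β * |F b| + N) := h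
      _ = (ε₁ * |F b| + ε₁ * N / β) * β := by field_simp
  calc |∑ b ∈ Cs, F b - (∑ b ∈ Cs, S b) / β| = |∑ b ∈ Cs, (F b - S b / β)| := by
        rw [Finset.sum_sub_distrib, Finset.sum_div]
    _ ≤ ∑ b ∈ Cs, |F b - S b / β| := Finset.abs_sum_le_sum_abs _ _
    _ ≤ ∑ b ∈ Cs, (ε₁ * |F b| + ε₁ * N / β) := Finset.sum_le_sum hterm
    _ = ε₁ * ∑ b ∈ Cs, |F b| + ε₁ * N * Cs.card / β := by
        rw [Finset.sum_add_distrib, Finset.mul_sum, Finset.sum_const, nsmul_eq_mul]; ring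

/-- THE COSET DISCREPANCY, abstract form (see the file header for the dictionary of symbols). -/
theorem coset_discrepancy_abstract : ∀ {ι : Type*} (C Cs : Finset ι), Cs ⊆ C → ∀ (F G S 𝔖 : ι → ℝ) (β W N ε₁ ε₂ C₀ LTF P E₄ E₅ Smax Deg ρ : ℝ), 0 < β → 0 ≤ ε₁ → 0 ≤ C₀ → 0 ≤ LTF → 0 ≤ P → 0 ≤ Smax → (∀ b ∈ Cs, |S b - β * F b| ≤ ε₁ * (β * |F b| + N)) → (∀ b ∈ Cs, |F b| ≤ C₀ * (𝔖 b + 1)) → (∀ b ∈ Cs, |𝔖 b - G b| ≤ ε₂) → |∑ b ∈ C, S b - W * LTF * P| ≤ E₄ → |∑ b ∈ Cs, 𝔖 b - LTF * C.card| ≤ E₅ → (∀ b ∈ C, 0 ≤ S b) → (∀ b ∈ C \ Cs, S b ≤ Smax) → ((C \ Cs).card : ℝ) ≤ Deg → |(C.card : ℝ) - P| ≤ ρ * P → |∑ b ∈ Cs, (F b - G b)| ≤ |W / β - 1| * LTF * P + (E₄ + Deg * Smax) / β + ε₁ * (C₀ * (LTF * C.card + E₅ + Cs.card)) + ε₁ *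 N * Cs.card / β + E₅ + ε₂ * Cs.card + LTF * (ρ * P) := by
  intro ι C Cs hCs F G S 𝔖 β W N ε₁ ε₂ C₀ LTF P E₄ E₅ Smax Deg ρ hβ hε₁ hC₀ hLTF hP hSmax h1 h2 h3 h4 h5
    h6 h6' h7 h8
  -- Step 1: the core on the window
  have step1 := abs_sum_sub_sum_div_le Cs F S hβ h1
  -- Step 2: a priori bound summed
  have step2 : ∑ b ∈ Cs, |F b| ≤ C₀ * (LTF * C.card + E₅ + Cs.card) := by
    have hs : ∑ b ∈ Cs, 𝔖 b ≤ LTF * C.card + E₅ := by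
      have := (abs_le.1 h5).2; linarith
    calc ∑ b ∈ Cs, |F b| ≤ ∑ b ∈ Cs, C₀ * (𝔖 b + 1) := Finset.sum_le_sum h2
      _ = C₀ * (∑ b ∈ Cs, 𝔖 b + Cs.card) := by
          rw [← Finset.mul_sum, Finset.sum_add_distrib, Finset.sum_const, nsmul_eq_mul, mul_one]
      _ ≤ C₀ * (LTF * C.card + E₅ + Cs.card) := by
          apply mul_le_mul_of_nonneg_left _ hC₀; linarith
  -- Step 3: the degenerate part
  have hsplit : ∑ b ∈ Cs, S b = ∑ b ∈ C, S b - ∑ b ∈ C \ Cs, S b := by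
    rw [← Finset.sum_sdiff hCs]; ring
  have hdeg0 : 0 ≤ ∑ b ∈ C \ Cs, S b :=
    Finset.sum_nonneg fun b hb => h6 b (Finset.mem_sdiff.1 hb).1
  have hdeg1 : ∑ b ∈ C \ Cs, S b ≤ Deg * Smax := by
    calc ∑ b ∈ C \ Cs, S b ≤ ∑ b ∈ C \ Cs, Smax := Finset.sum_le_sum h6'
      _ = (C \ Cs).card * Smax := by rw [Finset.sum_const, nsmul_eq_mul]
      _ ≤ Deg * Smax := mul_le_mul_of_nonneg_right h7 hSmax
  have step3 : |∑ b ∈ Cs, S b - W * LTF * P| ≤ E₄ + Deg * Smax := by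
    rw [hsplit, abs_le]
    have := abs_le.1 h4
    constructor <;> nlinarith [this.1, this.2, hdeg0, hdeg1]
  -- Step 4: divide by β
  have step4 : |(∑ b ∈ Cs, S b) / β - LTF * P| ≤ (E₄ + Deg * Smax) / β + |W / β - 1| * LTF * P := by
    have hid : (∑ b ∈ Cs, S b) / β - LTF * P =
        (∑ b ∈ Cs, S b - W * LTF * P) / β + (W / β - 1) * (LTF * P) := by
      field_simp; ring
    rw [hid]
    calc |(∑ b ∈ Cs, S b - W * LTF * P) / β + (W / β - 1) * (LTF * P)|
        ≤ |(∑ b ∈ Cs, S b - W * LTF * P) / β| + |(W / β - 1) * (LTF * P)| := abs_add_le _ _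
      _ ≤ (E₄ + Deg * Smax) / β + |W / β - 1| * LTF * P := by
          rw [abs_div, abs_of_pos hβ, abs_mul, abs_of_nonneg (mul_nonneg hLTF hP)]
          have hA : |∑ b ∈ Cs, S b - W * LTF * P| / β ≤ (E₄ + Deg * Smax) / β :=
            div_le_div_of_nonneg_right step3 hβ.le
          linarith
  -- Step 5: the singular-series side
  have step5 : |∑ b ∈ Cs, G b - LTF * P| ≤ ε₂ * Cs.card + E₅ + LTF * (ρ * P) := by
    have hG : |∑ b ∈ Cs, G b - ∑ b ∈ Cs, 𝔖 b| ≤ ε₂ * Cs.card := by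
      calc |∑ b ∈ Cs, G b - ∑ b ∈ Cs, 𝔖 b| = |∑ b ∈ Cs, (G b - 𝔖 b)| := by rw [Finset.sum_sub_distrib]
        _ ≤ ∑ b ∈ Cs, |G b - 𝔖 b| := Finset.abs_sum_le_sum_abs _ _
        _ ≤ ∑ b ∈ Cs, ε₂ := Finset.sum_le_sum fun b hb => by rw [abs_sub_comm]; exact h3 b hb
        _ = ε₂ * Cs.card := by rw [Finset.sum_const, nsmul_eq_mul, mul_comm]
    have hL : |LTF * C.card - LTF * P| ≤ LTF * (ρ * P) := by
      rw [← mul_sub, abs_mul, abs_of_nonneg hLTF]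
      exact mul_le_mul_of_nonneg_left h8 hLTF
    calc |∑ b ∈ Cs, G b - LTF * P|
        = |(∑ b ∈ Cs, G b - ∑ b ∈ Cs, 𝔖 b) + (∑ b ∈ Cs, 𝔖 b - LTF * C.card) + (LTF * C.card - LTF * P)| := by
          ring_nf
      _ ≤ |∑ b ∈ Cs, G b - ∑ b ∈ Cs, 𝔖 b| + |∑ b ∈ Cs, 𝔖 b - LTF * C.card| + |LTF * C.card - LTF * P| := by
          refine le_trans (abs_add_le _ _) ?_
          linarith [abs_add_le (∑ b ∈ Cs, G b - ∑ b ∈ Cs, 𝔖 b) (∑ b ∈ Cs, 𝔖 b - LTF * C.card)]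
      _ ≤ ε₂ * Cs.card + E₅ + LTF * (ρ * P) := by linarith
  -- Combine
  have hstep1' : |∑ b ∈ Cs, F b - (∑ b ∈ Cs, S b) / β| ≤
      ε₁ * (C₀ * (LTF * C.card + E₅ + Cs.card)) + ε₁ * N * Cs.card / β := by
    refine le_trans step1 ?_
    have := mul_le_mul_of_nonneg_left step2 hε₁
    linarith
  calc |∑ b ∈ Cs, (F b - G b)|
      = |(∑ b ∈ Cs, F b - (∑ b ∈ Cs, S b) / β) + ((∑ b ∈ Cs, S b) / β - LTF * P) +
          (LTF * P - ∑ b ∈ Cs, G b)| := by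
        rw [Finset.sum_sub_distrib]; ring_nf
    _ ≤ |∑ b ∈ Cs, F b - (∑ b ∈ Cs, S b) / β| + |(∑ b ∈ Cs, S b) / β - LTF * P| +
          |LTF * P - ∑ b ∈ Cs, G b| := abs_add_three _ _ _
    _ ≤ _ := by
        rw [abs_sub_comm (LTF * P)]
        linarith [hstep1', step4, step5]

end Summit.Parity.GeneralizedHardyLittlewood.Cruxes.RelativeDimOne.GallagherBackwardsSplit
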